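import Summits.BirchSwinnertonDyer.BirchSwinnertonDyer.Theorems.KimAtThreeFineKatoKPortJunctionLog
import Summits.BirchSwinnertonDyer.Rank1Residual.Additive.PadicBallLogSurj
import Summits.BirchSwinnertonDyer.Rank1Residual.Additive.AdditiveFormalLogBallIsometry
import HarnessLib

/-!
# The completion `L_w` at ANY place `w ∣ p` (ramified or not) as a complete ultrametric normed `ℚ_p`-ALGEBRA
# (`‖·‖` of base `p^{1/e(w∣p)}`, so `‖p‖ = p⁻¹`), and the points side at `L_w`: every `y` with `‖y‖ ≤ 1/4` is
# `log_ω` of a point of `W ⊗ L_w` (route `KimAtThreeKolyvagin`, rung W2, cruxes 19076 / 19560; seat w2-c3 gen 8)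

HONEST FRAMING. Definitions (a TYPE SYNONYM of `L_w` with instances on the synonym only — nothing on Mathlib's
types is overridden — in the pattern of kport's accepted `KimAtThreeFineKatoKPortJunctionDefs`) and theorems;
no named fact, no `sorry`; nothing is closed or booked; BSD is not proved by any of this.

WHY. The per-factor lattice bound hLatᵘ of item 20013 (w2-c2 g9 `KimAtThreeDeepLowerKatoParts`, cruxes
19075 / 19076) and hLog₀'s clause (e) (crux 19560) need, at EVERY place `w₀ ∣ 3` of `ℚ(ζ_m)` — including the
RAMIFIED ones (`3 ∣ m`, `e(w₀∣3) = 2`) — points of `E(L_{w₀})` whose logarithms fill a ball `p^c 𝒪_{w₀}`, so that the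
trace-dual description of `range(exp*_ω)` ((S5b-tower)) bounds its denominators. x1b's local surjectivity
`BallEval.exists_ptLog_eq` and kport's junction (J4a) `satLog_eq_padicLogPointFiniteExt` are stated for an ABSTRACT
complete ultrametric normed `ℚ_p`-algebra field `K`; kport's synonym `KPort.Kw p L w` carries `NormedAlgebra ℚ_[p]`
only for UNRAMIFIED `w` (its norm has base `p`, so `‖p‖ = p^{-e}`). THIS FILE removes that restriction:

* `Kwe p L w` — the synonym `L_w` with kport's structures (`Field`, `Valued _ ℤᵐ⁰`, the packet's `ℚ_v`- and `ℚ_[p]`-algebra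
  structures, `CompleteSpace`) but the rank-one structure of BASE `p^{1/e(w∣p)}` (`Kwe.base`, `one_lt_base`,
  `base_pow_ramIdx`), hence `‖x‖ = (p^{1/e})^{v_w(x)}` (`norm_def'`), `‖x‖ ≤ 1 ↔ x ∈ 𝒪_w`
  (`norm_le_one_iff_mem_adicCompletionIntegers`), **`norm_natCast_prime : ‖p‖ = p⁻¹` for EVERY `w`**,
  **`norm_algebraMap_eq : ‖algebraMap r‖ = ‖r‖`**, and the instances **`NormedAlgebra ℚ_[p] (Kwe p L w)`**,
  `FiniteDimensional ℚ_[p] (Kwe p L w)` (ultrametric and complete from the valued structure);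
  `valuation_isEquiv_valued` / `valuation_isEquiv_of_compatible` (the norm valuation is equivalent to `Valued.v`
  and to every compatible `ν`), **`compatible_normValuation`** (read on `L_w` it IS a compatible `ℝ≥0`-valuation:
  the `[ν.Compatible]` binder of (S5b)/(S5b-tower) is inhabited).
* `exists_point_padicLogPointFiniteExt_eq` — **every `y` with `‖y‖ ≤ 1/4` is `padicLogPointFiniteExt ν (W ⊗ L_w) p P′`
  for some point `P′`**, for every compatible `ν` making the model integral and every `w ∣ p` (BallEval on `Kwe`,
  `satLog_of_mem`, (J4a), (J4b) `padicLogPointFiniteExt_apply_eq_of_isEquiv`, the model identity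
  `curveK_integralModelInt_eq_baseChange`); `exists_point_padicLogPointFiniteExt_eq_sq_mul` — **every element of
  `p² 𝒪_w` is a logarithm** (`‖p² o‖ ≤ p⁻² ≤ 1/4`).

References: [SilvermanAEC2009] Thm. IV.6.4, Prop. VII.2.2; [SerreLocalFields1979] Ch. II §1–§2;
[CasselsFrohlichANT1967] Ch. II §10.
-/

noncomputable section

-- the cell's Theorems namespace `Summit.BirchSwinnertonDyer.BirchSwinnertonDyer.…` repeats the summit name by design (D-0017)
set_option linter.dupNamespace false

open scoped NNReal NumberField Classical
open IsDedekindDomain NumberField WithZeroMulInt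

namespace Summit.BirchSwinnertonDyer.BirchSwinnertonDyer.Theorems.KimAtThreeDeepUpperFactorFieldNorm

open Summit.BirchSwinnertonDyer.Rank1Residual.Additive Summit.BirchSwinnertonDyer.Rank1Residual.Additive.BallEval
open Literature.NumberTheory.EllipticCurves.Rank1Residual
open Literature.NumberTheory.GaloisRepresentations.LubinTate (unitBall mem_unitBall_iff)
open Literature.NumberTheory.EllipticCurves Literature.NumberTheory.EllipticCurves.FormalGroupChart
open Literature.NumberTheory.AdelicBaseChange
open Summit.BirchSwinnertonDyer.BirchSwinnertonDyer.Theorems.KPort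
open WeierstrassCurve

variable (p : ℕ) [hp : Fact p.Prime] (L : Type) [Field L] [NumberField L]
  (w : ((Rat.HeightOneSpectrum.primesEquiv (R := 𝓞 ℚ)).symm ⟨p, hp.out⟩).Extension (𝓞 L))

/-- **`K_w^{(e)}`**: the completion `L_w = w.1.adicCompletion L` at a place `w ∣ p` as a TYPE SYNONYM, to be
normed with base `p^{1/e(w∣p)}` (so that `‖p‖ = p⁻¹` for EVERY ramification index). [folklore] -/
def Kwe : Type := w.1.adicCompletion L

namespace Kwe

/-- The field structure of `L_w`. [folklore] -/
instance instField : Field (Kwe p L w) := inferInstanceAs (Field (w.1.adicCompletion L))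

/-- The `w`-adic valuation of `L_w` (values in `ℤᵐ⁰`), with its valued-field topology. [folklore] -/
instance instValued : Valued (Kwe p L w) (WithZero (Multiplicative ℤ)) :=
  inferInstanceAs (Valued (w.1.adicCompletion L) (WithZero (Multiplicative ℤ)))

/-- The valuation is discrete of rank one. [folklore] -/
instance instIsRankOneDiscrete : (Valued.v : Valuation (Kwe p L w) (WithZero (Multiplicative ℤ))).IsRankOneDiscrete :=
  inferInstanceAs ((Valued.v : Valuation (w.1.adicCompletion L) (WithZero (Multiplicative ℤ))).IsRankOneDiscrete)

/-- The ramification index `e(w∣p)`. [folklore] -/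
def ramIdx : ℕ := w.1.asIdeal.ramificationIdx (𝓞 ℚ)

/-- `e(w∣p) ≠ 0`. [cite: CasselsFrohlichANT1967, Ch. II §10] -/
theorem ramIdx_ne_zero : ramIdx p L w ≠ 0 :=
  HeightOneSpectrum.ramificationIdx_ne_zero (𝓞 ℚ) (𝓞 L)
    (algebraMap_injective_of_field_isFractionRing (R := 𝓞 ℚ) (S := 𝓞 L) ℚ L) w.1

/-- The base `p^{1/e(w∣p)} ∈ ℝ≥0` of the norm. [folklore] -/
def base : ℝ≥0 := (p : ℝ≥0) ^ ((ramIdx p L w : ℝ)⁻¹)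

/-- `1 < p^{1/e}`. [folklore] -/
theorem one_lt_base : 1 < base p L w := by
  rw [base, ← NNReal.coe_lt_coe, NNReal.coe_one, NNReal.coe_rpow, NNReal.coe_natCast]
  exact Real.one_lt_rpow (by exact_mod_cast hp.out.one_lt)
    (inv_pos.mpr (by exact_mod_cast Nat.pos_of_ne_zero (ramIdx_ne_zero p L w)))

/-- `p^{1/e} ≠ 0`. [folklore] -/
theorem base_ne_zero : base p L w ≠ 0 := ne_of_gt (lt_trans zero_lt_one (one_lt_base p L w))

/-- `(p^{1/e})^e = p`. [folklore] -/
theorem base_pow_ramIdx : base p L w ^ ramIdx p L w = (p : ℝ≥0) := by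
  rw [base, ← NNReal.rpow_natCast, ← NNReal.rpow_mul,
    inv_mul_cancel₀ (Nat.cast_ne_zero.mpr (ramIdx_ne_zero p L w)), NNReal.rpow_one]

/-- **The rank-one structure of BASE `p^{1/e(w∣p)}`** on the `w`-adic valuation. [cite: SerreLocalFields1979, Ch. II §1] -/
instance rankOne : (Valued.v : Valuation (Kwe p L w) (WithZero (Multiplicative ℤ))).RankOne :=
  Valuation.IsRankOneDiscrete.rankOne _ (one_lt_base p L w)

/-- **`K_w^{(e)}` as a nontrivially normed field**, `‖x‖ = (p^{1/e})^{v_w(x)}` (Mathlib `Valued.toNontriviallyNormedField`;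
the uniformity is the valued one). [cite: SerreLocalFields1979, Ch. II §1] -/
instance instNontriviallyNormedField : NontriviallyNormedField (Kwe p L w) :=
  Valued.toNontriviallyNormedField (Kwe p L w) (WithZero (Multiplicative ℤ))

/-- `K_w^{(e)}` is complete (it is `L_w`). [folklore] -/
instance instCompleteSpace : CompleteSpace (Kwe p L w) := inferInstanceAs (CompleteSpace (w.1.adicCompletion L))

/-- The `ℚ_v`-algebra structure of `L_w` (packet). [cite: CasselsFrohlichANT1967, Ch. II §10] -/
instance instAlgebraCompletion :
    Algebra (((Rat.HeightOneSpectrum.primesEquiv (R := 𝓞 ℚ)).symm ⟨p, hp.out⟩).adicCompletion ℚ) (Kwe p L w) :=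
  inferInstanceAs (Algebra (((Rat.HeightOneSpectrum.primesEquiv (R := 𝓞 ℚ)).symm ⟨p, hp.out⟩).adicCompletion ℚ)
    (w.1.adicCompletion L))

/-- `L_w` is finite over `ℚ_v` (packet). [cite: CasselsFrohlichANT1967, Ch. II §10] -/
instance instModuleFiniteCompletion :
    Module.Finite (((Rat.HeightOneSpectrum.primesEquiv (R := 𝓞 ℚ)).symm ⟨p, hp.out⟩).adicCompletion ℚ) (Kwe p L w) :=
  inferInstanceAs (Module.Finite (((Rat.HeightOneSpectrum.primesEquiv (R := 𝓞 ℚ)).symm ⟨p, hp.out⟩).adicCompletion ℚ)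
    (w.1.adicCompletion L))

/-- The `ℚ_[p]`-algebra structure `(ℚ_v → L_w) ∘ e_p` (kport's (J2)). [cite: CasselsFrohlichANT1967, Ch. II §10] -/
instance instAlgebraPadic : Algebra ℚ_[p] (Kwe p L w) :=
  ((algebraMap (((Rat.HeightOneSpectrum.primesEquiv (R := 𝓞 ℚ)).symm ⟨p, hp.out⟩).adicCompletion ℚ)
      (w.1.adicCompletion L)).comp
    (Padic.adicCompletionEquiv (𝓞 ℚ) ⟨p, hp.out⟩).toRingEquiv.toRingHom).toAlgebra

/-- The identity `K_w^{(e)} = L_w` as a ring isomorphism. [folklore] -/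
def toCompletion : Kwe p L w ≃+* w.1.adicCompletion L := RingEquiv.refl _

variable {p L w}

/-- `toCompletion` is the identity. [folklore] -/
@[simp] theorem toCompletion_apply (x : Kwe p L w) : toCompletion p L w x = (x : w.1.adicCompletion L) := rfl

/-- The valuation of `K_w^{(e)}` is that of `L_w`. [folklore] -/
theorem valued_toCompletion (x : Kwe p L w) :
    Valued.v (toCompletion p L w x) = (Valued.v x : WithZero (Multiplicative ℤ)) := rfl

/-- `algebraMap ℚ_[p] K_w^{(e)} = (algebraMap ℚ_v L_w) ∘ e_p`. [folklore] -/
theorem algebraMap_eq (r : ℚ_[p]) :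
    toCompletion p L w (algebraMap ℚ_[p] (Kwe p L w) r) =
      algebraMap (((Rat.HeightOneSpectrum.primesEquiv (R := 𝓞 ℚ)).symm ⟨p, hp.out⟩).adicCompletion ℚ)
        (w.1.adicCompletion L) (Padic.adicCompletionEquiv (𝓞 ℚ) ⟨p, hp.out⟩ r) := rfl

/-- The `hom'` of the rank-one structure. [folklore] -/
theorem rankOne_hom'_def :
    (rankOne p L w).hom' = (toNNReal (base_ne_zero p L w)).comp
      (MonoidWithZeroHom.ofClass (Valuation.IsRankOneDiscrete.valueGroup₀_equiv_withZeroMulInt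
        (Valued.v : Valuation (Kwe p L w) (WithZero (Multiplicative ℤ))))) := rfl

/-- The valuation of `K_w^{(e)}` is onto `ℤᵐ⁰`. [folklore] -/
theorem valued_surjective : Function.Surjective (Valued.v : Valuation (Kwe p L w) (WithZero (Multiplicative ℤ))) :=
  w.1.valuedAdicCompletion_surjective L

/-- **`‖x‖ = (p^{1/e})^{v_w(x)}`**. [cite: SerreLocalFields1979, Ch. II §1] -/
theorem norm_def' (x : Kwe p L w) : ‖x‖ = toNNReal (base_ne_zero p L w) (Valued.v x) := by
  simp [Valued.toNormedField.norm_def, Valuation.RankOne.hom, rankOne_hom'_def,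
    Valuation.IsRankOneDiscrete.valueGroup₀_equiv_withZeroMulInt_restrict_apply_of_surjective valued_surjective]

/-- `‖x‖ ≤ 1 ↔ v_w(x) ≤ 1`. [cite: SerreLocalFields1979, Ch. II §1] -/
theorem norm_le_one_iff (x : Kwe p L w) : ‖x‖ ≤ 1 ↔ Valued.v x ≤ (1 : WithZero (Multiplicative ℤ)) := by
  rw [norm_def', ← NNReal.coe_one, NNReal.coe_le_coe, ← (toNNReal_strictMono (one_lt_base p L w)).le_iff_le, map_one]

/-- The unit ball of `K_w^{(e)}` is `𝒪_w`. [cite: SerreLocalFields1979, Ch. II §1] -/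
theorem norm_le_one_iff_mem_adicCompletionIntegers (x : Kwe p L w) :
    ‖x‖ ≤ 1 ↔ toCompletion p L w x ∈ w.1.adicCompletionIntegers L := by
  rw [norm_le_one_iff, HeightOneSpectrum.mem_adicCompletionIntegers]; rfl

/-- `‖x‖ = (p^{1/e})^n` when `v_w(x) = exp n`. [cite: SerreLocalFields1979, Ch. II §1] -/
theorem norm_eq_zpow {x : Kwe p L w} {n : ℤ} (hx : Valued.v x = (WithZero.exp n : WithZero (Multiplicative ℤ))) :
    ‖x‖ = ((base p L w : ℝ≥0) : ℝ) ^ n := by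
  rw [norm_def', hx]
  simp [toNNReal, WithZero.exp]

/-- `v_w(ι y) = v_p(y)^{e(w∣p)}` for `ι : ℚ_v → K_w^{(e)}` (packet). [cite: CasselsFrohlichANT1967, Ch. II §10] -/
theorem valued_algebraMap_completion (y : ((Rat.HeightOneSpectrum.primesEquiv (R := 𝓞 ℚ)).symm ⟨p, hp.out⟩).adicCompletion ℚ) :
    Valued.v (algebraMap _ (Kwe p L w) y) = (Valued.v y : WithZero (Multiplicative ℤ)) ^ ramIdx p L w :=
  HeightOneSpectrum.Extension.valued_adicCompletionSemialgHom ℚ L w y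

/-- **`v_w(p) = exp(−e(w∣p))`**. [cite: CasselsFrohlichANT1967, Ch. II §10] -/
theorem valued_natCast_prime :
    Valued.v ((p : ℕ) : Kwe p L w) = (WithZero.exp (-(ramIdx p L w : ℤ)) : WithZero (Multiplicative ℤ)) := by
  rw [← map_natCast (algebraMap (((Rat.HeightOneSpectrum.primesEquiv (R := 𝓞 ℚ)).symm ⟨p, hp.out⟩).adicCompletion ℚ)
    (Kwe p L w)) p, valued_algebraMap_completion, Kw.valued_completion_natCast_prime, ← WithZero.exp_nsmul]
  simp

/-- **`‖p‖ = p⁻¹` in `K_w^{(e)}` for EVERY `w ∣ p`** (`(p^{1/e})^{−e} = p⁻¹`). [cite: SerreLocalFields1979, Ch. II §1] -/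
theorem norm_natCast_prime : ‖((p : ℕ) : Kwe p L w)‖ = (p : ℝ)⁻¹ := by
  rw [norm_eq_zpow (n := -(ramIdx p L w : ℤ)) valued_natCast_prime, zpow_neg, zpow_natCast, ← NNReal.coe_pow,
    base_pow_ramIdx, NNReal.coe_natCast]

/-- `algebraMap` carries `ℤ_p` into the unit ball (`e_p(ℤ_p) = 𝒪_v`, `𝒪_v → 𝒪_w`). [cite: CasselsFrohlichANT1967, Ch. II §10] -/
theorem norm_algebraMap_padicInt_le_one (s : ℤ_[p]) : ‖algebraMap ℚ_[p] (Kwe p L w) (s : ℚ_[p])‖ ≤ 1 := by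
  rw [norm_le_one_iff_mem_adicCompletionIntegers, algebraMap_eq]
  have hs : Padic.adicCompletionEquiv (𝓞 ℚ) ⟨p, hp.out⟩ (s : ℚ_[p]) ∈
      ((Rat.HeightOneSpectrum.primesEquiv (R := 𝓞 ℚ)).symm ⟨p, hp.out⟩).adicCompletionIntegers ℚ := by
    rw [← PadicInt.coe_adicCompletionIntegersEquiv_apply]
    exact (PadicInt.adicCompletionIntegersEquiv (𝓞 ℚ) ⟨p, hp.out⟩ s).2
  exact w.adicCompletionSemialgHom_image_adicCompletionIntegers ℚ L ⟨_, hs, rfl⟩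

/-- `‖r‖ ≤ 1 ⇒ ‖algebraMap r‖ ≤ 1`. [cite: CasselsFrohlichANT1967, Ch. II §10] -/
theorem norm_algebraMap_le_one_of_norm_le_one {r : ℚ_[p]} (hr : ‖r‖ ≤ 1) :
    ‖algebraMap ℚ_[p] (Kwe p L w) r‖ ≤ 1 :=
  norm_algebraMap_padicInt_le_one (⟨r, hr⟩ : ℤ_[p])

/-- Units of `ℤ_p` go to elements of norm `1`. [cite: SerreLocalFields1979, Ch. II §2] -/
theorem norm_algebraMap_eq_one_of_norm_eq_one {u : ℚ_[p]} (hu : ‖u‖ = 1) :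
    ‖algebraMap ℚ_[p] (Kwe p L w) u‖ = 1 := by
  have hu0 : u ≠ 0 := norm_pos_iff.mp (by rw [hu]; exact one_pos)
  have h1 : ‖algebraMap ℚ_[p] (Kwe p L w) u‖ ≤ 1 := norm_algebraMap_le_one_of_norm_le_one hu.le
  have h2 : ‖algebraMap ℚ_[p] (Kwe p L w) u⁻¹‖ ≤ 1 :=
    norm_algebraMap_le_one_of_norm_le_one (by rw [norm_inv, hu, inv_one])
  have h12 : ‖algebraMap ℚ_[p] (Kwe p L w) u‖ * ‖algebraMap ℚ_[p] (Kwe p L w) u⁻¹‖ = 1 := by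
    rw [← norm_mul, ← map_mul, mul_inv_cancel₀ hu0, map_one, norm_one]
  refine le_antisymm h1 ?_
  calc (1 : ℝ) = ‖algebraMap ℚ_[p] (Kwe p L w) u‖ * ‖algebraMap ℚ_[p] (Kwe p L w) u⁻¹‖ := h12.symm
    _ ≤ ‖algebraMap ℚ_[p] (Kwe p L w) u‖ * 1 := mul_le_mul_of_nonneg_left h2 (norm_nonneg _)
    _ = ‖algebraMap ℚ_[p] (Kwe p L w) u‖ := mul_one _

/-- **The norm of `K_w^{(e)}` extends `|·|_p`** for EVERY `w ∣ p`: `‖algebraMap r‖ = ‖r‖` (write `r = u · p^n`).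
[cite: SerreLocalFields1979, Ch. II §2] -/
theorem norm_algebraMap_eq (r : ℚ_[p]) : ‖algebraMap ℚ_[p] (Kwe p L w) r‖ = ‖r‖ := by
  by_cases hr : r = 0
  · rw [hr, map_zero, norm_zero, norm_zero]
  have hp0 : (p : ℚ_[p]) ≠ 0 := Nat.cast_ne_zero.mpr hp.out.ne_zero
  have hpR : (p : ℝ) ≠ 0 := Nat.cast_ne_zero.mpr hp.out.ne_zero
  set u : ℚ_[p] := r * (p : ℚ_[p]) ^ (-r.valuation) with hu_def
  have hu : ‖u‖ = 1 := by
    rw [hu_def, norm_mul, Padic.norm_p_zpow, Padic.norm_eq_zpow_neg_valuation hr, ← zpow_add₀ hpR, neg_neg,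
      neg_add_cancel, zpow_zero]
  have hr' : r = u * (p : ℚ_[p]) ^ r.valuation := by
    rw [hu_def, mul_assoc, ← zpow_add₀ hp0, neg_add_cancel, zpow_zero, mul_one]
  rw [hr', map_mul, norm_mul, norm_mul, norm_algebraMap_eq_one_of_norm_eq_one hu, hu, map_zpow₀, norm_zpow,
    map_natCast, norm_natCast_prime, Padic.norm_p_zpow, inv_zpow', zpow_neg]

/-- **`NormedAlgebra ℚ_[p] K_w^{(e)}` for EVERY place `w ∣ p`** (ramified or not). [cite: SerreLocalFields1979, Ch. II §2] -/
instance instNormedAlgebra : NormedAlgebra ℚ_[p] (Kwe p L w) :=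
  { (inferInstance : Algebra ℚ_[p] (Kwe p L w)) with
    norm_smul_le := fun r x => by
      rw [Algebra.smul_def, norm_mul, norm_algebraMap_eq] }

/-- `K_w^{(e)}` is finite-dimensional over `ℚ_[p]`. [cite: CasselsFrohlichANT1967, Ch. II §10] -/
instance instFiniteDimensional : FiniteDimensional ℚ_[p] (Kwe p L w) := by
  letI : Algebra ℚ_[p] (((Rat.HeightOneSpectrum.primesEquiv (R := 𝓞 ℚ)).symm ⟨p, hp.out⟩).adicCompletion ℚ) :=
    (Padic.adicCompletionEquiv (𝓞 ℚ) ⟨p, hp.out⟩).toRingEquiv.toRingHom.toAlgebra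
  haveI : IsScalarTower ℚ_[p] (((Rat.HeightOneSpectrum.primesEquiv (R := 𝓞 ℚ)).symm ⟨p, hp.out⟩).adicCompletion ℚ)
      (Kwe p L w) := IsScalarTower.of_algebraMap_eq fun r => rfl
  haveI : Module.Finite ℚ_[p] (((Rat.HeightOneSpectrum.primesEquiv (R := 𝓞 ℚ)).symm ⟨p, hp.out⟩).adicCompletion ℚ) :=
    Module.Finite.of_surjective (Algebra.linearMap ℚ_[p] _)
      (Padic.adicCompletionEquiv (𝓞 ℚ) ⟨p, hp.out⟩).surjective
  exact Module.Finite.trans (((Rat.HeightOneSpectrum.primesEquiv (R := 𝓞 ℚ)).symm ⟨p, hp.out⟩).adicCompletion ℚ) (Kwe p L w)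

/-- `K_w^{(e)}` is an ultrametric space (inherited from the valued structure). [folklore] -/
theorem isUltrametricDist : IsUltrametricDist (Kwe p L w) := inferInstance

/-- The norm valuation `‖·‖₊` of `K_w^{(e)}` is equivalent to `Valued.v` (same unit ball). [cite: SerreLocalFields1979, Ch. II §1] -/
theorem valuation_isEquiv_valued :
    (NormedField.valuation : Valuation (Kwe p L w) ℝ≥0).IsEquiv
      (Valued.v : Valuation (Kwe p L w) (WithZero (Multiplicative ℤ))) := by
  rw [Valuation.isEquiv_iff_val_le_one]
  intro x
  rw [NormedField.valuation_apply, ← NNReal.coe_le_coe, coe_nnnorm, NNReal.coe_one]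
  exact norm_le_one_iff x

/-- The norm valuation of `K_w^{(e)}` is equivalent to every `ℝ≥0`-valued valuation `ν` of `L_w` compatible with its
valuative relation (read on the synonym along the identity). [cite: SerreLocalFields1979, Ch. II §1] -/
theorem valuation_isEquiv_of_compatible (ν : Valuation (w.1.adicCompletion L) ℝ≥0) [ν.Compatible] :
    (NormedField.valuation : Valuation (Kwe p L w) ℝ≥0).IsEquiv (ν.comap (toCompletion p L w).toRingHom) := by
  have h1 := valuation_isEquiv_valued (p := p) (L := L) (w := w)
  have h2 : (ν.comap (toCompletion p L w).toRingHom).IsEquiv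
      (Valued.v : Valuation (Kwe p L w) (WithZero (Multiplicative ℤ))) := by
    rw [Valuation.isEquiv_iff_val_le_one]
    intro x
    rw [Valuation.comap_apply, ← valued_toCompletion x]
    exact (ValuativeRel.isEquiv ν (Valued.v : Valuation (w.1.adicCompletion L) (WithZero (Multiplicative ℤ)))).le_one_iff_le_one
  exact h1.trans h2.symm

/-- **The norm valuation of `K_w^{(e)}`, read on `L_w`, is compatible with the valuative relation of `L_w`** — a
compatible `ℝ≥0`-valued valuation of `L_w` EXISTS (the `[ν.Compatible]` binder of (S5b)/(S5b-tower)). [cite: SerreLocalFields1979, Ch. II §1] -/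
theorem compatible_normValuation :
    ((NormedField.valuation : Valuation (Kwe p L w) ℝ≥0).comap (toCompletion p L w).symm.toRingHom).Compatible := by
  refine ⟨fun x y => ?_⟩
  have hV := (Valuation.Compatible.vle_iff_le (v := (Valued.v : Valuation (w.1.adicCompletion L)
    (WithZero (Multiplicative ℤ)))) x y)
  rw [hV]
  exact (valuation_isEquiv_valued (p := p) (L := L) (w := w) ((toCompletion p L w).symm x)
    ((toCompletion p L w).symm y)).symm

end Kwe

/-! ### The points side at `L_w`: `log_ω` of `W ⊗ L_w` attains every small value, for every `w ∣ p` -/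

section Points

variable {p L} {w}
-- the theorems below are instance-POLYMORPHIC in the `ℚ`-algebra structure of `L_w` used to form `W ⊗ L_w`
-- (the consumers' statements carry `letI := LocalField.charZero_adicCompletion …`, under which class inference
-- may pick a different — propositionally equal, `Subsingleton (ℚ →+* L_w)` — structure than the packet's)
variable [Algebra ℚ (w.1.adicCompletion L)] (W : WeierstrassCurve ℚ) [W.IsGloballyMinimal]

/-- kport's model over the synonym is Mathlib's base change: `curveK p K_w^{(e)} (W_ℤ ⊗ ℤ_p) = W ⊗ L_w` (for ANY
`ℚ`-algebra structure on `L_w`: ring homomorphisms `ℤ → L_w` are unique). [folklore] -/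
theorem curveK_integralModelInt_eq_baseChange :
    curveK p (Kwe p L w) ((integralModelInt W).map (Int.castRingHom ℤ_[p])) = W.baseChange (w.1.adicCompletion L) := by
  have hW := map_integralModelInt W
  unfold curveK
  rw [WeierstrassCurve.map_map]
  conv_rhs => rw [← hW, WeierstrassCurve.baseChange, WeierstrassCurve.map_map]
  congr 1
  exact Subsingleton.elim _ _

omit [Algebra ℚ (w.1.adicCompletion L)] in
/-- A `ν`-integral equation over `L_w` is integral for `ν` read on the synonym. [folklore] -/
theorem isIntegral_comap_toCompletion (ν : Valuation (w.1.adicCompletion L) ℝ≥0)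
    (V : WeierstrassCurve (w.1.adicCompletion L)) [hV : V.IsIntegral ν.integer] :
    @WeierstrassCurve.IsIntegral (ν.comap (Kwe.toCompletion p L w).toRingHom).integer _ (Kwe p L w) _ _ V :=
  isIntegral_integer_of_val_le_one (val_a₁_le_one (w := ν) (V := V)) (val_a₂_le_one (w := ν) (V := V))
    (val_a₃_le_one (w := ν) (V := V)) (val_a₄_le_one (w := ν) (V := V)) (val_a₆_le_one (w := ν) (V := V))

omit [Algebra ℚ (w.1.adicCompletion L)] in
/-- Reading `log_ω` on the synonym (definitional). [folklore] -/
theorem padicLogPointFiniteExt_comap_toCompletion (ν : Valuation (w.1.adicCompletion L) ℝ≥0)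
    (V : WeierstrassCurve (w.1.adicCompletion L)) [hV : V.IsIntegral ν.integer] (q : ℕ) (P : V.toAffine.Point) :
    @padicLogPointFiniteExt (Kwe p L w) (Kwe.instField p L w) (ν.comap (Kwe.toCompletion p L w).toRingHom) V q
        (isIntegral_comap_toCompletion (p := p) ν V) P = padicLogPointFiniteExt ν V q P :=
  rfl

/-- **Every `y ∈ L_w` with `‖y‖ ≤ 1/4` (norm of base `p^{1/e}`) is `log_ω` of a point of `W ⊗ L_w`**, for every
compatible `ν` making the model integral and EVERY place `w ∣ p`: x1b's local surjectivity `BallEval.exists_ptLog_eq` on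
the complete ultrametric normed `ℚ_p`-algebra `K_w^{(e)}`, read through kport's junction
(`satLog_of_mem`, (J4a) `satLog_eq_padicLogPointFiniteExt`, (J4b) `padicLogPointFiniteExt_apply_eq_of_isEquiv`).
[cite: SilvermanAEC2009, Thm. IV.6.4 with Prop. VII.2.2] -/
theorem exists_point_padicLogPointFiniteExt_eq [W.IsElliptic] (ν : Valuation (w.1.adicCompletion L) ℝ≥0) [ν.Compatible]
    [hν : (W.baseChange (w.1.adicCompletion L)).IsIntegral ν.integer]
    (y : Kwe p L w) (hy : ‖y‖ ≤ 1 / 4) :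
    ∃ P' : (W.baseChange (w.1.adicCompletion L)).toAffine.Point,
      padicLogPointFiniteExt ν (W.baseChange (w.1.adicCompletion L)) p P' = Kwe.toCompletion p L w y := by
  set M : WeierstrassCurve ℤ_[p] := (integralModelInt W).map (Int.castRingHom ℤ_[p]) with hM
  haveI hE : (M.map PadicInt.Coe.ringHom).IsElliptic := isElliptic_map_coe_integralModelInt W p
  haveI hint : (curveK p (Kwe p L w) M).IsIntegral (NormedField.valuation (K := Kwe p L w)).integer :=
    isIntegral_curveK p (Kwe p L w) M
  obtain ⟨P, hP, hlog, -⟩ := exists_ptLog_eq (p := p) (K := Kwe p L w) (M := M) hy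
  have hsat : satLog p (Kwe p L w) M P = y := by rw [satLog_of_mem hP, hlog]
  have hC := curveK_integralModelInt_eq_baseChange (p := p) (L := L) (w := w) W
  have hequiv := Kwe.valuation_isEquiv_of_compatible (p := p) (L := L) (w := w) ν
  haveI hν₁ : (curveK p (Kwe p L w) M).IsIntegral (ν.comap (Kwe.toCompletion p L w).toRingHom).integer :=
    isIntegral_of_isEquiv hequiv _
  haveI hν₂ := isIntegral_comap_toCompletion (p := p) ν (W.baseChange (w.1.adicCompletion L))
  obtain ⟨P', hP'⟩ := Kw.exists_point_padicLogPointFiniteExt_eq_of_eq (ν.comap (Kwe.toCompletion p L w).toRingHom) hC p P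
  refine ⟨P', ?_⟩
  rw [← padicLogPointFiniteExt_comap_toCompletion (p := p) ν (W.baseChange (w.1.adicCompletion L)) p P', hP',
    Kwe.toCompletion_apply, ← hsat, satLog_eq_padicLogPointFiniteExt, padicLogPointFiniteExt_apply_eq_of_isEquiv hequiv p P]

/-- **Every element of `p² 𝒪_w` is `log_ω` of a point of `W ⊗ L_w`** (`‖p² o‖ ≤ p⁻² ≤ 1/4`), for every compatible
`ν` making the model integral and every place `w ∣ p`. [cite: SilvermanAEC2009, Thm. IV.6.4 with Prop. VII.2.2] -/
theorem exists_point_padicLogPointFiniteExt_eq_sq_mul [W.IsElliptic] (ν : Valuation (w.1.adicCompletion L) ℝ≥0) [ν.Compatible]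
    [hν : (W.baseChange (w.1.adicCompletion L)).IsIntegral ν.integer]
    (o : w.1.adicCompletion L) (ho : o ∈ w.1.adicCompletionIntegers L) :
    ∃ P' : (W.baseChange (w.1.adicCompletion L)).toAffine.Point,
      padicLogPointFiniteExt ν (W.baseChange (w.1.adicCompletion L)) p P' = (p : w.1.adicCompletion L) ^ 2 * o := by
  have hy : ‖((p : ℕ) : Kwe p L w) ^ 2 * (Kwe.toCompletion p L w).symm o‖ ≤ 1 / 4 := by
    have ho' : ‖(Kwe.toCompletion p L w).symm o‖ ≤ 1 :=
      (Kwe.norm_le_one_iff_mem_adicCompletionIntegers _).mpr ho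
    rw [norm_mul, norm_pow, Kwe.norm_natCast_prime]
    have hp2 : (2 : ℝ) ≤ p := by exact_mod_cast hp.out.two_le
    have hp0 : (0 : ℝ) < p := by linarith
    calc ((p : ℝ)⁻¹) ^ 2 * ‖(Kwe.toCompletion p L w).symm o‖ ≤ ((2 : ℝ)⁻¹) ^ 2 * 1 := by
          refine mul_le_mul ?_ ho' (norm_nonneg _) (by positivity)
          exact pow_le_pow_left₀ (inv_nonneg.mpr hp0.le) ((inv_le_inv₀ hp0 two_pos).mpr hp2) 2
      _ = 1 / 4 := by norm_num
  obtain ⟨P', hP'⟩ := exists_point_padicLogPointFiniteExt_eq (p := p) (L := L) (w := w) W ν _ hy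
  exact ⟨P', by rw [hP']; rfl⟩

end Points

end Summit.BirchSwinnertonDyer.BirchSwinnertonDyer.Theorems.KimAtThreeDeepUpperFactorFieldNorm

end
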